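import Summits.Ventures.HSemireg.WedgeHankelPairKernel
import Summits.Ventures.HSemireg.WedgeHankelSecantRank

/-!
# Venture HSemireg — THE SECANT KERNEL LAW: `Kr(univ, w_m(Σ_{i<r} A_i λ_i^•), k) = ⋂_{i<r} F_{λ_i}(k)` for `r ≤ min(k+1, m+1−k)`,
# and FRAMES IN GENERAL POSITION: `dim ⋂_{i<r} F_{λ_i}(k) = C(2m,k) − r·C(m,k)`

HONEST FRAMING. Part of the Lean index of the computation cell `pub-hsemireg` (seat p10 gen 14, Sunday typer «UNIFORM-IN-n»).
Finite-dimensional EXTERIOR ALGEBRA over a field and ranks of HANKEL MATRICES ONLY: no variety, no cohomology theory, no sheaf, no Ext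
group and no semiregularity map is constructed here; nothing here says that HC / HC_CM / HC_AV holds; no Literature fact is declared or
used.  Custodian versions cited: theory/FORMULA-N.md PART A §2.6 THEOREM H and its KRONECKER DICTIONARY (ranks `ρ = 1` pure, `ρ = 2`
FN-1's pairs / `K`-secants, `ρ = k+1` generic); STRUCTURE.md v1.0-SIGNED 9b196a05977dd067 §1.1 C15.  The dictionary (`Σ_{i<r} A_i exp(λ_i Θ)`
↦ the coefficient sequence `q_j = Σ_i A_i λ_i^j` ↦ th-7's Hankel class `w_m(q)`; `⌟v` on `HT^k` ↦ `θ ↦ θ ∧ w_m(q)` on `⋀^k K^{2m}`) is QUOTED,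
never asserted.

WHAT IS KEYED.  Gen 13 named the kernel space `Kr(univ, w_m(q), k)` for the classes of Hankel rank `1` (`WedgeHankelPureKernel.Kr_w_expSeq`:
the FRAME IDEAL `F_λ(k) = Σ_{a<m} (x_a + λ y_a) ∧ Hom(univ, k−1)`) and rank `2` (`WedgeHankelPairKernel.Kr_w_tpSeq`: `F_λ(k) ∩ F_μ(k)`,
`0 < k < m`); gen 14's `WedgeHankelSecantRank` computed `rank H_k(Σ_{i<r} A_i λ_i^•) = min(r, k+1)` for `r ≤ m+1−k`.  THIS FILE names
the kernel for EVERY Hankel rank `r ≤ min(k+1, m+1−k)` at once: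
* §1 `w` is additive over finite sums (`w_sum'`); **`w_secSeq`: `w_j(Σ_i A_i λ_i^•) = Σ_i A_i · u^{λ_i}_0 ∧ ⋯ ∧ u^{λ_i}_{j−1}`** — an `r`-secant
  class is the sum of its `r` (decomposable) pure classes.
* §2 **`iInf_frameIdeal_le_Kr_secSeq`**: a form killing every exponential kills the secant, `⋂_i F_{λ_i}(k) ≤ Kr(univ, w_m(q), k)` (`k ≥ 1`).
* §3 CODIMENSION IS SUBADDITIVE (`finrank_le_finrank_inf_inf_add`, any finite family of subspaces of a subspace `H`):
  `dim H ≤ dim(H ∩ ⋂_i F_i) + Σ_i (dim H − dim F_i)`; hence `C(2m,k) ≤ dim ⋂_{i<r} F_{λ_i}(k) + r·C(m,k)` for ANY slopes (`iInf_frameIdeal_ge`).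
* §4 **THE SECANT KERNEL LAW `Kr_w_secSeq`: for distinct `λ_i`, non-zero `A_i`, `1 ≤ k`, `r ≤ k + 1` and `r ≤ m + 1 − k`:
  `Kr(univ, w_m(Σ_{i<r} A_i λ_i^•), k) = ⋂_{i<r} F_{λ_i}(k)`** — THE FORMS KILLING A SECANT CLASS ARE EXACTLY THOSE KILLING EACH OF ITS
  EXPONENTIALS (containment §2 + the count `C(2m,k) − r·C(m,k)` from the secant rank law + §3); independent of the weights (`Kr_w_secSeq_indep`);
  wedge form `ker_wedge_w_secSeq`.  `r = 1`, `2` are C6's and C10's theorems (`k ≤ m`, resp. `k < m`); `r = 3, …` are new.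
* §5 **FRAMES IN GENERAL POSITION `finrank_iInf_frameIdeal_add`: `dim ⋂_{i<r} F_{λ_i}(k) + r·C(m,k) = C(2m,k)`** for any `r ≤ min(k+1, m+1−k)`
  distinct slopes — the `r` quotients `Hom(univ,k)/F_{λ_i}(k)` (each of dimension `C(m,k)`) are independent; a statement about frame ideals alone,
  proved THROUGH the Hankel rank of the secant class.  Beyond the range (`k + 1 ≤ r ≤ m + 1 − k`) the kernel NUMBER is the generic one,
  `dim Kr + (k+1)·C(m,k) = C(2m,k)` (`finrank_Kr_w_secSeq_add_of_le`) — its NAME (gen 11's Siegel ideal `SI_k`) is the next leaf.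
Namespace `Summit.Ventures.HSemireg.Wedge.HankelSecant` (continued); new names only.
-/

open Module

namespace Summit.Ventures.HSemireg.Wedge.HankelSecant

open Summit.Ventures.HSemireg.Wedge Summit.Ventures.HSemireg.Wedge.Kunneth Summit.Ventures.HSemireg.Wedge.KunnethKernel
  Summit.Ventures.HSemireg.Wedge.HankelFaces Summit.Ventures.HSemireg.Wedge.HankelPureKernel

variable (K : Type*) [Field K] (m : ℕ)

/-! ## §1. A secant class is the sum of its pure classes -/

/-- the class of the zero sequence vanishes (private; cf. the tree's `Wedge.Hankel.w_zero`). -/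
private lemma w_zero' (j : ℕ) : Hankel.w K m j (0 : ℕ → K) = 0 := by
  have h := w_smul' K (m := m) (0 : K) j (0 : ℕ → K)
  rwa [zero_smul, zero_smul] at h

/-- th-7's Hankel class is additive over finite sums of coefficient sequences. -/
lemma w_sum' (j : ℕ) {ι : Type*} (s : Finset ι) (q : ι → ℕ → K) :
    Hankel.w K m j (∑ i ∈ s, q i) = ∑ i ∈ s, Hankel.w K m j (q i) := by
  classical
  refine Finset.induction_on s ?_ ?_
  · rw [Finset.sum_empty, Finset.sum_empty, w_zero']
  · intro a s ha ih
    rw [Finset.sum_insert ha, Finset.sum_insert ha, w_add', ih]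

/-- a secant sequence is the sum of its exponential sequences. -/
lemma secSeq_eq_sum {r : ℕ} (A lam : Fin r → K) : secSeq K A lam = ∑ i, expSeq K (A i) (lam i) := by
  funext j
  rw [Finset.sum_apply]
  rfl

/-- **`w_j(Σ_i A_i λ_i^•) = Σ_i A_i · u^{λ_i}_0 ∧ ⋯ ∧ u^{λ_i}_{j−1}`**: an `r`-secant class is the sum of its `r` (decomposable) pure classes. -/
theorem w_secSeq {r : ℕ} (A lam : Fin r → K) (j : ℕ) :
    Hankel.w K m j (secSeq K A lam) = ∑ i, A i • uprod K m (lam i) j := by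
  rw [secSeq_eq_sum, w_sum']
  exact Finset.sum_congr rfl fun i _ => w_expSeq K (A i) (lam i) j

/-! ## §2. A form killing every exponential kills the secant -/

/-- **`⋂_{i<r} F_{λ_i}(k) ≤ Kr(univ, w_m(Σ_i A_i λ_i^•), k)`** (`k ≥ 1`, `r ≥ 1`): each frame ideal is the kernel space of its exponential (C6),
and the secant class is a combination of the exponentials' classes. -/
theorem iInf_frameIdeal_le_Kr_secSeq {r : ℕ} (hr : 0 < r) (A lam : Fin r → K) {k : ℕ} (hk : 1 ≤ k) :
    (⨅ i, frameIdeal K m (uvec K m (lam i)) k) ≤ Kr K Finset.univ (Hankel.w K m m (secSeq K A lam)) k := by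
  intro θ hθ
  rw [Submodule.mem_iInf] at hθ
  have h : ∀ i, θ ∈ Hom K (Hankel.In m) Finset.univ k ∧ θ * uprod K m (lam i) m = 0 := by
    intro i
    have hi := hθ i
    rw [← Kr_w_expSeq K m one_ne_zero (lam i) hk, mem_Kr, w_expSeq, one_smul] at hi
    exact hi
  refine mem_Kr.mpr ⟨(h ⟨0, hr⟩).1, ?_⟩
  rw [w_secSeq, Finset.mul_sum]
  refine Finset.sum_eq_zero fun i _ => ?_
  rw [mul_smul_comm, (h i).2, smul_zero]

/-- the intersection of `r ≥ 1` frame ideals lies in `Hom(univ, k)` (`k ≥ 1`). -/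
lemma iInf_frameIdeal_le_Hom {r : ℕ} (hr : 0 < r) (lam : Fin r → K) {k : ℕ} (hk : 1 ≤ k) :
    (⨅ i, frameIdeal K m (uvec K m (lam i)) k) ≤ Hom K (Hankel.In m) Finset.univ k :=
  (iInf_frameIdeal_le_Kr_secSeq K m hr (fun _ => (1 : K)) lam hk).trans (Kr_le_Hom K _ _ _)

/-! ## §3. Codimension is subadditive -/

/-- **CODIMENSION IS SUBADDITIVE**: for subspaces `F_i ≤ H` (`i ∈ s`) of a finite-dimensional space,
`dim H ≤ dim (H ∩ ⋂_{i∈s} F_i) + Σ_{i∈s} (dim H − dim F_i)`. -/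
theorem finrank_le_finrank_inf_inf_add {M : Type*} [AddCommGroup M] [Module K M] [FiniteDimensional K M] {ι : Type*}
    (s : Finset ι) (H : Submodule K M) (F : ι → Submodule K M) (hF : ∀ i ∈ s, F i ≤ H) :
    finrank K H ≤ finrank K ↥(H ⊓ s.inf F) + ∑ i ∈ s, (finrank K H - finrank K (F i)) := by
  classical
  induction s using Finset.induction_on with
  | empty => rw [Finset.inf_empty, inf_top_eq, Finset.sum_empty, add_zero]
  | insert a s ha ih =>
    have hF' : ∀ i ∈ s, F i ≤ H := fun i hi => hF i (Finset.mem_insert_of_mem hi)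
    have haH : F a ≤ H := hF a (Finset.mem_insert_self a s)
    have ih' := ih hF'
    rw [Finset.sum_insert ha, Finset.inf_insert, ← inf_assoc, inf_right_comm]
    have key := Submodule.finrank_sup_add_finrank_inf_eq (H ⊓ s.inf F) (F a)
    have hsup : finrank K ↥((H ⊓ s.inf F) ⊔ F a) ≤ finrank K H :=
      Submodule.finrank_mono (sup_le inf_le_left haH)
    have hFa : finrank K (F a) ≤ finrank K H := Submodule.finrank_mono haH
    omega

/-- `dim Hom(univ, k) = C(2m, k)` on th-7's model (private copy). -/
private lemma finrank_Hom_univ (k : ℕ) : finrank K (Hom K (Hankel.In m) Finset.univ k) = (m + m).choose k := by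
  rw [Hom_univ_eq_exteriorPower, exteriorPower.finrank_eq, finrank_fintype_fun_eq_card, Fintype.card_fin]

/-- hence, for ANY slopes `λ_0, …, λ_{r−1}` (`r ≥ 1`, `k ≥ 1`): **`C(2m,k) ≤ dim ⋂_{i<r} F_{λ_i}(k) + r·C(m,k)`** — each frame ideal has
codimension `C(m,k)` in `Hom(univ,k)` (C6's `finrank_frameIdeal_uvec`). -/
theorem iInf_frameIdeal_ge {r : ℕ} (hr : 0 < r) (lam : Fin r → K) {k : ℕ} (hk : 1 ≤ k) :
    (m + m).choose k ≤ finrank K ↥(⨅ i, frameIdeal K m (uvec K m (lam i)) k) + r * m.choose k := by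
  have h := finrank_le_finrank_inf_inf_add K Finset.univ (Hom K (Hankel.In m) Finset.univ k)
    (fun i => frameIdeal K m (uvec K m (lam i)) k)
    (fun i _ => by rw [← Kr_w_expSeq K m one_ne_zero (lam i) hk]; exact Kr_le_Hom K _ _ _)
  have hinf : (Hom K (Hankel.In m) Finset.univ k ⊓ Finset.univ.inf fun i => frameIdeal K m (uvec K m (lam i)) k) =
      ⨅ i, frameIdeal K m (uvec K m (lam i)) k := by
    rw [Finset.inf_univ_eq_iInf]
    exact inf_eq_right.mpr (iInf_frameIdeal_le_Hom K m hr lam hk)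
  rw [hinf, finrank_Hom_univ] at h
  simp only [finrank_frameIdeal_uvec K m _ hk, Finset.sum_const, Finset.card_univ, Fintype.card_fin, smul_eq_mul] at h
  have hle : m.choose k ≤ (m + m).choose k := Nat.choose_le_choose k (by omega)
  have hsub : (m + m).choose k - ((m + m).choose k - m.choose k) = m.choose k := by omega
  rw [hsub] at h
  exact h

/-! ## §4. The secant kernel law -/

/-- `V(univ, f, a)` is the range of th-7's `θ ↦ θ ∧ f ∣ ⋀^a` (private; cf. C3's `V_univ_w`). -/
private lemma V_univ_eq_range (a : ℕ) (f : HT K (Hankel.In m)) :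
    V K (Hankel.In m) Finset.univ f a = LinearMap.range (Hankel.wedge K m a f) := by
  rw [V_eq_map, Hom_univ_eq_exteriorPower, Hankel.wedge, LinearMap.range_comp, Submodule.range_subtype]

/-- per-degree rank–nullity against THEOREM H (private copy of C3's `finrank_Kr_w_add`):
`dim Kr(univ, w_m(q), a) + C(m,a)·rank H_a(q) = C(2m,a)`. -/
private lemma finrank_Kr_w_add' (a : ℕ) (q : ℕ → K) :
    finrank K (Kr K Finset.univ (Hankel.w K m m q) a) + m.choose a * (Hankel.hankel1 K m a q).rank = (m + m).choose a := by
  have h := finrank_Kr_add_finrank_V K (Finset.univ : Finset (Hankel.In m)) (Hankel.w K m m q) a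
  rw [Finset.card_univ, Fintype.card_fin, V_univ_eq_range, Hankel.hankelLaw_model] at h
  exact h

/-- the kernel NUMBER of an `r`-secant class (`r ≤ k + 1`, `r ≤ m + 1 − k`, distinct slopes, non-zero weights):
**`dim Kr(univ, w_m(Σ_i A_i λ_i^•), k) + r·C(m,k) = C(2m,k)`** (the secant rank law + rank–nullity). -/
theorem finrank_Kr_w_secSeq_add {r k : ℕ} (hrk : r ≤ k + 1) (hrm : r ≤ m + 1 - k) {A lam : Fin r → K} (hA : ∀ i, A i ≠ 0)
    (hlam : Function.Injective lam) :
    finrank K (Kr K Finset.univ (Hankel.w K m m (secSeq K A lam)) k) + r * m.choose k = (m + m).choose k := by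
  have h := finrank_Kr_w_add' K m k (secSeq K A lam)
  rw [rank_hankel1_secSeq hrk hrm hA hlam, Nat.mul_comm] at h
  exact h

/-- beyond the range — MORE NODES THAN ROWS (`k + 1 ≤ r ≤ m + 1 − k`): the kernel number is the generic one,
**`dim Kr + (k+1)·C(m,k) = C(2m,k)`**, whatever the non-zero weights. -/
theorem finrank_Kr_w_secSeq_add_of_le {r k : ℕ} (hkr : k + 1 ≤ r) (hrm : r ≤ m + 1 - k) {A lam : Fin r → K}
    (hA : ∀ i, A i ≠ 0) (hlam : Function.Injective lam) :
    finrank K (Kr K Finset.univ (Hankel.w K m m (secSeq K A lam)) k) + (k + 1) * m.choose k = (m + m).choose k := by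
  have h := finrank_Kr_w_add' K m k (secSeq K A lam)
  rw [rank_hankel1_secSeq_of_le hkr hrm hA hlam, Nat.mul_comm] at h
  exact h

/-- **THE SECANT KERNEL LAW.**  For distinct slopes `λ_0, …, λ_{r−1}` (`r ≥ 1`), non-zero weights `A_i`, and a degree `k ≥ 1` with
`r ≤ k + 1` and `r ≤ m + 1 − k`:
**`Kr(univ, w_m(Σ_{i<r} A_i λ_i^•), k) = ⋂_{i<r} F_{λ_i}(k)`** — the degree-`k` forms killing the secant class are EXACTLY the forms
killing each of its `r` exponentials (every field, every `m`).  `r = 1`: C6's `Kr_w_expSeq`; `r = 2`: C10's `Kr_w_tpSeq`. -/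
theorem Kr_w_secSeq {r : ℕ} (hr : 0 < r) {k : ℕ} (hk : 1 ≤ k) (hrk : r ≤ k + 1) (hrm : r ≤ m + 1 - k)
    {A lam : Fin r → K} (hA : ∀ i, A i ≠ 0) (hlam : Function.Injective lam) :
    Kr K Finset.univ (Hankel.w K m m (secSeq K A lam)) k = ⨅ i, frameIdeal K m (uvec K m (lam i)) k := by
  refine (Submodule.eq_of_le_of_finrank_le (iInf_frameIdeal_le_Kr_secSeq K m hr A lam hk) ?_).symm
  have h1 := finrank_Kr_w_secSeq_add K m hrk hrm hA hlam
  have h2 := iInf_frameIdeal_ge K m hr lam hk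
  omega

/-- in particular **the kernel of a secant class does not depend on its (non-zero) weights**. -/
theorem Kr_w_secSeq_indep {r : ℕ} (hr : 0 < r) {k : ℕ} (hk : 1 ≤ k) (hrk : r ≤ k + 1) (hrm : r ≤ m + 1 - k)
    {A A' lam : Fin r → K} (hA : ∀ i, A i ≠ 0) (hA' : ∀ i, A' i ≠ 0) (hlam : Function.Injective lam) :
    Kr K Finset.univ (Hankel.w K m m (secSeq K A lam)) k = Kr K Finset.univ (Hankel.w K m m (secSeq K A' lam)) k := by
  rw [Kr_w_secSeq K m hr hk hrk hrm hA hlam, Kr_w_secSeq K m hr hk hrk hrm hA' hlam]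

/-- wedge form: **`ker(θ ↦ θ ∧ w_m(Σ_i A_i λ_i^•) ∣ ⋀^k) = ⋂_{i<r} F_{λ_i}(k)`** (comapped), same hypotheses. -/
theorem ker_wedge_w_secSeq {r : ℕ} (hr : 0 < r) {k : ℕ} (hk : 1 ≤ k) (hrk : r ≤ k + 1) (hrm : r ≤ m + 1 - k)
    {A lam : Fin r → K} (hA : ∀ i, A i ≠ 0) (hlam : Function.Injective lam) :
    LinearMap.ker (wedge K (Hankel.In m) k (Hankel.w K m m (secSeq K A lam))) =
      (⨅ i, frameIdeal K m (uvec K m (lam i)) k).comap (⋀[K]^k (Hankel.In m → K)).subtype := by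
  rw [ker_wedge_eq_comap_Kr, Kr_w_secSeq K m hr hk hrk hrm hA hlam]

/-! ## §5. Frames in general position -/

/-- **FRAMES IN GENERAL POSITION: `dim ⋂_{i<r} F_{λ_i}(k) + r·C(m,k) = C(2m,k)`** for distinct slopes `λ_0, …, λ_{r−1}`, `r ≥ 1`,
`k ≥ 1`, `r ≤ k + 1`, `r ≤ m + 1 − k` (every field, `m`) — the `r` quotients `Hom(univ,k)/F_{λ_i}(k)`, each of dimension `C(m,k)`, are
independent.  (`r = 2` is C10's `finrank_frameIdeal_inf`, there for every `k ≥ 1`.) -/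
theorem finrank_iInf_frameIdeal_add {r : ℕ} (hr : 0 < r) {k : ℕ} (hk : 1 ≤ k) (hrk : r ≤ k + 1) (hrm : r ≤ m + 1 - k)
    {lam : Fin r → K} (hlam : Function.Injective lam) :
    finrank K ↥(⨅ i, frameIdeal K m (uvec K m (lam i)) k) + r * m.choose k = (m + m).choose k := by
  rw [← Kr_w_secSeq K m hr hk hrk hrm (A := fun _ => (1 : K)) (fun _ => one_ne_zero) hlam]
  exact finrank_Kr_w_secSeq_add K m hrk hrm (fun _ => one_ne_zero) hlam

/-- every frame vector `u^{λ_i}_a` of every slope kills nothing new: for `2 ≤ r` distinct slopes (`r ≤ m`) **no `1`-form kills the secant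
class** — `Kr(univ, w_m(Σ_i A_i λ_i^•), 1) = 0` (the `r` frames meet trivially). -/
theorem Kr_w_secSeq_one_eq_bot {r : ℕ} (h2 : 2 ≤ r) (hrm : r ≤ m) {A lam : Fin r → K} (hA : ∀ i, A i ≠ 0)
    (hlam : Function.Injective lam) : Kr K Finset.univ (Hankel.w K m m (secSeq K A lam)) 1 = ⊥ := by
  apply Submodule.finrank_eq_zero.mp
  have h := finrank_Kr_w_secSeq_add_of_le K m (k := 1) (by omega) (by omega) hA hlam
  have h1 : m.choose 1 = m := Nat.choose_one_right m
  have h2' : (m + m).choose 1 = m + m := Nat.choose_one_right (m + m)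
  rw [h1, h2'] at h
  omega

end Summit.Ventures.HSemireg.Wedge.HankelSecant
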